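import Literature.NumberTheory.ConnesConsani2021.ArchKernelL1Frame
import Literature.NumberTheory.ConnesConsani2021.ArchKernelL1PanelFrame
import Literature.NumberTheory.ConnesConsani2021.SeriesRemainderParametricTail
import HarnessLib

/-!
# The (E-a) enclosure from a panel certificate: the statement a future kernel certificate decides

RH-FREE corpus literature (label, line 1): this file only COMPOSES the G-elimination
(`ArchKernelL1Frame.lean`: `CC2021_section6_enclosures ↔ ∫_{[−log 2, log 2]} |τ_c − ϖ| ≤ 1/400`) with
the `L¹` panel frame (`ArchKernelL1PanelFrame.lean`); nothing here mentions `ζ`, the critical strip or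
RH, and nothing here bears on the truth of RH.  bears_on (cell rh-crit, corpus C1): apex input (C) —
route «ConnesConsaniSemilocal» item K3 `WindowSpectralBound` (stmt 19306).

STATUS (cell rulings, 2026-08-26): director-rh 07:13:15Z — the in-kernel (E-a) certificate is NOT
STAFFED this wave; cc-lead R93 (3) — analytic frame (Tier 1) only.  `section6_enclosures_of_panels`
below lists EXACTLY the finitely many obligations of the deferred Tier-2 certificate (interval
arithmetic decided by `decide`, in the style of `EpsSlopeKernel.lean` / `SpectralCertCheck.lean`):
(1) a slope enclosure `e⁻ ≤ Σ t(n) ≤ e⁺` (t15's `SlopeCert.tsum_epsSlopeTerm_prolateFun_mem` is the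
instance `[22.9, 23.1]`; the certificate will want ≈ 4 more digits), (2) a uniform truncation bound
`|Σ_{n ≥ N₁} τ(n)T_n(ρ)| ≤ T` on `[1,2]` (App. F Lemma F.1; NOTE: a NUMERICALLY small majorant for
`n ≥ N₁` is needed — the tree's unconditional decay `summable_abs_prolateEigen_mul_sq` is qualitative,
[Osipov 2013, Thm 33] is vacuous below index ≈ 26, and the printed `2.366·10⁻¹²` at `N = 10` rests on
(rapid-decay), conjecture-class in print — so the certificate either encloses the modes `n < N₁ ≈ 26`
or discharges a sharper decay input), (3) per-panel sup bounds
`|2ẽ·τ_c(log ρ) − Σ_{n<N₁} τ(n)T_n(ρ)| ≤ M_k` on rational `ρ`-panels of `[1,2]` (Frobenius data via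
`ProlateContinuation` (99) and the `EpsSlopeFrobenius*` toolkit), (4) the bound `‖τ_c‖ ≤ B` and
(5) one rational inequality.  It proves none of them.

Source: A. Connes, C. Consani, *Weil positivity and trace formula, the archimedean place*, Selecta
Math. (N.S.) 27 (2021) 77 = arXiv:2006.13771 [bib `ConnesConsani2021`], §6.3–6.4 p. 24 (`ϖ`,
Fact 6.1, Lemma 6.3), Prop. 5.3 p. 32, Lemma 5.4 pp. 32–33, App. F Lemma F.1 (arXiv Lemma 49) p. 55.

WHAT THIS FILE IS NOT: a certificate, a discharge of (E-a), or anything about RH.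
-/

noncomputable section

open Real Set MeasureTheory Filter Topology

namespace Literature.NumberTheory.ConnesConsani2021

open Literature.NumberTheory.LFunctions

/-- RH-FREE. On `[1, 2]` the series (97) `S(ρ) = Σ' τ(n)T_n(ρ)` is `2ε′(1₊)·ϖ(log ρ)`; in particular
it is continuous there (`continuous_prolateVarpi`).
[cite: ConnesConsani2021, §6.3 p. 24; Prop. 5.3 eqs. (97)–(98) p. 32] -/
theorem tsum_sonineQTerm_prolateFun_eq_prolateVarpi {ρ : ℝ} (hρ : 1 ≤ ρ) :
    ∑' n : ℕ, sonineQTerm (prolateFun n) (prolateEigen n) ρ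
      = 2 * (∑' n : ℕ, epsSlopeTerm (prolateFun n)) * prolateVarpi (Real.log ρ) := by
  have hρ0 : 0 < ρ := by linarith
  have he := tsum_epsSlopeTerm_prolateFun_pos
  rw [prolateVarpi_apply, abs_of_nonneg (Real.log_nonneg hρ), Real.exp_log hρ0]
  field_simp

/-- RH-FREE. Continuity of the series (97) on `[1, 2]`. [cite: ConnesConsani2021, Prop. 5.3 p. 32; §6.3 p. 24] -/
theorem continuousOn_tsum_sonineQTerm_prolateFun :
    ContinuousOn (fun ρ : ℝ ↦ ∑' n : ℕ, sonineQTerm (prolateFun n) (prolateEigen n) ρ) (Icc 1 2) := by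
  have hc : ContinuousOn
      (fun ρ : ℝ ↦ 2 * (∑' n : ℕ, epsSlopeTerm (prolateFun n)) * prolateVarpi (Real.log ρ)) (Icc 1 2) := by
    refine ContinuousOn.mul continuousOn_const ?_
    refine continuous_prolateVarpi.comp_continuousOn ?_
    exact Real.continuousOn_log.mono fun x hx ↦ by
      simp only [mem_compl_iff, mem_singleton_iff]; linarith [hx.1]
  exact hc.congr fun ρ hρ ↦ tsum_sonineQTerm_prolateFun_eq_prolateVarpi hρ.1

/-- RH-FREE. **The one (E-a) inequality from a panel certificate** — the `L¹` panel frame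
(`setIntegral_Icc_norm_sub_le_of_panels`) instantiated at `τ = τ_c` (the certificate kernel, real,
even: `SpectralCert.frameKernel_im/_neg`), `S = Σ' τ(n)T_n` (series (97)), `e = Σ' t(n)` (Lemma 5.4),
so that `S(e^{|v|})/(2e) = prolateVarpi v`.  Hypotheses = the Tier-2 obligations (module docstring).
[cite: ConnesConsani2021, §6.4 Fact 6.1 + Lemma 6.3 p. 24; §6.3 p. 24] -/
theorem L1_prolateVarpi_le_of_panels {elo ehi et T B : ℝ} {m N₁ : ℕ} {a M : ℕ → ℝ}
    (hB : ∀ v, ‖SpectralCert.frameKernel (-(Real.log 2 / 2)) (Real.log 2 / 2) SpectralCert.CertAF.N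
        (fun n ↦ (SpectralCert.CertAF.c n : ℝ)) v‖ ≤ B)
    (helo : 0 < elo)
    (he : elo ≤ ∑' n : ℕ, epsSlopeTerm (prolateFun n) ∧ ∑' n : ℕ, epsSlopeTerm (prolateFun n) ≤ ehi)
    (het : elo ≤ et ∧ et ≤ ehi)
    (hT : ∀ ρ ∈ Icc (1 : ℝ) 2,
      |∑' n : ℕ, sonineQTerm (prolateFun n) (prolateEigen n) ρ
        - ∑ n ∈ Finset.range N₁, sonineQTerm (prolateFun n) (prolateEigen n) ρ| ≤ T)
    (ha0 : a 0 = 1) (ham : a m = 2) (hmono : ∀ k < m, a k ≤ a (k + 1))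
    (hM : ∀ k < m, ∀ ρ ∈ Icc (a k) (a (k + 1)),
      |2 * et * (SpectralCert.frameKernel (-(Real.log 2 / 2)) (Real.log 2 / 2) SpectralCert.CertAF.N
            (fun n ↦ (SpectralCert.CertAF.c n : ℝ)) (Real.log ρ)).re
        - ∑ n ∈ Finset.range N₁, sonineQTerm (prolateFun n) (prolateEigen n) ρ| ≤ M k) :
    ∫ v in Icc (-Real.log 2) (Real.log 2),
        ‖SpectralCert.frameKernel (-(Real.log 2 / 2)) (Real.log 2 / 2) SpectralCert.CertAF.N
            (fun n ↦ (SpectralCert.CertAF.c n : ℝ)) v - ((prolateVarpi v : ℝ) : ℂ)‖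
      ≤ (1 / elo) * (∑ k ∈ Finset.range m, M k * ((a (k + 1) - a k) / a k)
          + (2 * (ehi - elo) * B + T)) := by
  have h := setIntegral_Icc_norm_sub_le_of_panels
    (τ := SpectralCert.frameKernel (-(Real.log 2 / 2)) (Real.log 2 / 2) SpectralCert.CertAF.N
      (fun n ↦ (SpectralCert.CertAF.c n : ℝ)))
    (S := fun ρ : ℝ ↦ ∑' n : ℕ, sonineQTerm (prolateFun n) (prolateEigen n) ρ)
    (P := fun ρ : ℝ ↦ ∑ n ∈ Finset.range N₁, sonineQTerm (prolateFun n) (prolateEigen n) ρ)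
    (e := ∑' n : ℕ, epsSlopeTerm (prolateFun n))
    (SpectralCert.continuous_frameKernel _ _ _ _) (SpectralCert.frameKernel_im _ _ _ _)
    (SpectralCert.frameKernel_neg _ _ _ _) hB continuousOn_tsum_sonineQTerm_prolateFun helo he het hT
    ha0 ham hmono hM
  simpa only [prolateVarpi_apply] using h

/-- RH-FREE. **`CC2021_section6_enclosures` from a panel certificate** (the (E-b) conjunct being the
kernel theorem `SlopeCert.epsSlope_enclosure_holds`, and (E-a) the one inequality,
`section6_enclosures_iff_L1`): the finitely many Tier-2 obligations plus ONE rational inequality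
`e⁻⁻¹(Σ_k M_k (a_{k+1}−a_k)/a_k + 2(e⁺−e⁻)B + T) ≤ 1/400` give the whole named fact — hence (via the
landed helper `windowSpectralBound_of_section6Enclosures` / cc-iso's K3 closer) route item K3.  The
certificate itself is DEFERRED (module docstring); this theorem is the frame it will instantiate.
[cite: ConnesConsani2021, §6.4 Fact 6.1 + Lemma 6.3 p. 24; §6.7 Lemma 6.10 / Thm. 6.11 p. 28] -/
theorem section6_enclosures_of_panels {elo ehi et T B : ℝ} {m N₁ : ℕ} {a M : ℕ → ℝ}
    (hB : ∀ v, ‖SpectralCert.frameKernel (-(Real.log 2 / 2)) (Real.log 2 / 2) SpectralCert.CertAF.N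
        (fun n ↦ (SpectralCert.CertAF.c n : ℝ)) v‖ ≤ B)
    (helo : 0 < elo)
    (he : elo ≤ ∑' n : ℕ, epsSlopeTerm (prolateFun n) ∧ ∑' n : ℕ, epsSlopeTerm (prolateFun n) ≤ ehi)
    (het : elo ≤ et ∧ et ≤ ehi)
    (hT : ∀ ρ ∈ Icc (1 : ℝ) 2,
      |∑' n : ℕ, sonineQTerm (prolateFun n) (prolateEigen n) ρ
        - ∑ n ∈ Finset.range N₁, sonineQTerm (prolateFun n) (prolateEigen n) ρ| ≤ T)
    (ha0 : a 0 = 1) (ham : a m = 2) (hmono : ∀ k < m, a k ≤ a (k + 1))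
    (hM : ∀ k < m, ∀ ρ ∈ Icc (a k) (a (k + 1)),
      |2 * et * (SpectralCert.frameKernel (-(Real.log 2 / 2)) (Real.log 2 / 2) SpectralCert.CertAF.N
            (fun n ↦ (SpectralCert.CertAF.c n : ℝ)) (Real.log ρ)).re
        - ∑ n ∈ Finset.range N₁, sonineQTerm (prolateFun n) (prolateEigen n) ρ| ≤ M k)
    (hcheck : (1 / elo) * (∑ k ∈ Finset.range m, M k * ((a (k + 1) - a k) / a k)
        + (2 * (ehi - elo) * B + T)) ≤ ((SpectralCert.CertAF.ε₁ : ℚ) : ℝ)) :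
    CC2021_section6_enclosures :=
  section6_enclosures_iff_L1.2
    ((L1_prolateVarpi_le_of_panels hB helo he het hT ha0 ham hmono hM).trans hcheck)

/-! ## The tail obligation `hT` from an index-wise majorant of `λ(n)` (App. F Lemma F.1 (i) packaging)

Appended 2026-08-26 (cc-lead R105: tail source of record = an explicit index-wise majorant
`|λ(n)| ≤ R(n)`, seat t15 g3's `ProlateEigenvalueExplicitDecay.lean`; fallback (ii) = the kernel-tail
regrouping, `cc/drafts/t7-K3-tail-ii-FULL.md`).  The adapter below turns ANY majorant package
(`R`, its validity from index `N₁` on, `R ≤ 13/200`, `Σ R·p < ∞`, ONE numeral `Σ_{n≥N₁} R(n)·4πp(n) ≤ T`)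
into the frame's hypothesis `hT`, through seat t6's landed `lemma_49_i_prolateFun_of_majorant`
((computersafe) with a parametric majorant).  Nothing here proves a majorant. -/

/-- RH-FREE. **`hT` from a majorant**: if `|λ(n)| ≤ R(n) ≤ 13/200` for `n ≥ N₁ ≥ 3`, `Σ R(n)p(n) < ∞`
(`p = remainderPoly`, App. F Lemma F.1) and `Σ_{k} R(k+N₁)·4πp(k+N₁) ≤ T`, then on `[1,2]`
`|Σ' τ(n)T_n(ρ) − Σ_{n<N₁} τ(n)T_n(ρ)| ≤ T`.
[cite: ConnesConsani2021, App. F Lemma F.1 (i) (arXiv Lemma 49) eq. (computersafe), arXiv PDF p. 55; Prop. 5.3 p. 32] -/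
theorem abs_tsum_sub_sum_sonineQTerm_le_of_majorant {N₁ : ℕ} (hN : 3 ≤ N₁) {R : ℕ → ℝ} {T : ℝ}
    (hR : ∀ n, N₁ ≤ n → |prolateEigen n| ≤ R n) (hR' : ∀ n, N₁ ≤ n → R n ≤ 13 / 200)
    (hRs : Summable (fun n ↦ R n * remainderPoly n))
    (hRT : ∑' k : ℕ, R (k + N₁) * (4 * π * remainderPoly (k + N₁)) ≤ T)
    {ρ : ℝ} (hρ : ρ ∈ Icc (1 : ℝ) 2) :
    |∑' n : ℕ, sonineQTerm (prolateFun n) (prolateEigen n) ρ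
        - ∑ n ∈ Finset.range N₁, sonineQTerm (prolateFun n) (prolateEigen n) ρ| ≤ T := by
  obtain ⟨N, rfl⟩ : ∃ N, N₁ = N + 1 := ⟨N₁ - 1, by omega⟩
  have hN2 : 2 ≤ N := by omega
  have h := lemma_49_i_prolateFun_of_majorant hN2 (r := R) (fun n hn ↦ hR n (by omega))
    (fun n hn ↦ hR' n (by omega)) hRs hρ
  rw [← (summable_sonineQTerm_prolateFun hρ).sum_add_tsum_nat_add (N + 1), add_sub_cancel_left]
  exact h.2.trans hRT

/-- RH-FREE. **`CC2021_section6_enclosures` from a panel certificate and a majorant** — the frame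
`section6_enclosures_of_panels` with its tail hypothesis supplied by
`abs_tsum_sub_sum_sonineQTerm_le_of_majorant`: Tier-2 obligations (1) `‖τ_c‖ ≤ B`, (2) the slope
enclosure, (3) the per-panel bounds for the modes `n < N₁` (identified BY INDEX via
`eq_prolateFun_of_exists_index_of_eigen_strictMono`, `ArchKernelModeIdentification.lean`), (4) ONE
numeral for the majorant tail and (5) the closing rational inequality; the majorant `R` itself is a
Tier-1 theorem (seat t15 g3) — none of it is proved here.
[cite: ConnesConsani2021, §6.4 Fact 6.1 + Lemma 6.3 p. 24; App. F Lemma F.1 (i) p. 55; §6.7 Lemma 6.10 / Thm. 6.11 p. 28] -/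
theorem section6_enclosures_of_panels_of_majorant {elo ehi et T B : ℝ} {m N₁ : ℕ} {a M : ℕ → ℝ}
    {R : ℕ → ℝ} (hN : 3 ≤ N₁)
    (hR : ∀ n, N₁ ≤ n → |prolateEigen n| ≤ R n) (hR' : ∀ n, N₁ ≤ n → R n ≤ 13 / 200)
    (hRs : Summable (fun n ↦ R n * remainderPoly n))
    (hRT : ∑' k : ℕ, R (k + N₁) * (4 * π * remainderPoly (k + N₁)) ≤ T)
    (hB : ∀ v, ‖SpectralCert.frameKernel (-(Real.log 2 / 2)) (Real.log 2 / 2) SpectralCert.CertAF.N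
        (fun n ↦ (SpectralCert.CertAF.c n : ℝ)) v‖ ≤ B)
    (helo : 0 < elo)
    (he : elo ≤ ∑' n : ℕ, epsSlopeTerm (prolateFun n) ∧ ∑' n : ℕ, epsSlopeTerm (prolateFun n) ≤ ehi)
    (het : elo ≤ et ∧ et ≤ ehi)
    (ha0 : a 0 = 1) (ham : a m = 2) (hmono : ∀ k < m, a k ≤ a (k + 1))
    (hM : ∀ k < m, ∀ ρ ∈ Icc (a k) (a (k + 1)),
      |2 * et * (SpectralCert.frameKernel (-(Real.log 2 / 2)) (Real.log 2 / 2) SpectralCert.CertAF.N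
            (fun n ↦ (SpectralCert.CertAF.c n : ℝ)) (Real.log ρ)).re
        - ∑ n ∈ Finset.range N₁, sonineQTerm (prolateFun n) (prolateEigen n) ρ| ≤ M k)
    (hcheck : (1 / elo) * (∑ k ∈ Finset.range m, M k * ((a (k + 1) - a k) / a k)
        + (2 * (ehi - elo) * B + T)) ≤ ((SpectralCert.CertAF.ε₁ : ℚ) : ℝ)) :
    CC2021_section6_enclosures :=
  section6_enclosures_of_panels hB helo he het
    (fun _ hρ ↦ abs_tsum_sub_sum_sonineQTerm_le_of_majorant hN hR hR' hRs hRT hρ)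
    ha0 ham hmono hM hcheck

end Literature.NumberTheory.ConnesConsani2021

end
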